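import Summits.QuantumFields.YangMills.Theses.UnitScaleTilt
import Literature.MathematicalPhysics.QuantumFieldTheory.Balaban1983to89.T3RegularMinimiser

/-!
# Route `UnitScaleTilt` — crux K1 `UnitTilt` (stmt-QuantumFields-18915) FROM THE REGULAR-BACKGROUND TWINS: the glue of the RESHAPED split
# `UnitTilt ⇐ MinimiserStabilityReg ∧ FluctuationComparisonReg` (support file; K1 and its children stay open)

Cell `ym3-torus` (HUMAN RULING D-0037, YM ladder rung R3), seat `ym3-torus-p1` gen 4; cell record HOME/UV3-NODE.md §11.4/§11.6.
`unitScaleTilt_unitTilt_of_reg`: if, for every `L`, for all sufficiently small regularity parameters `ε₀ > 0`, eventually in the free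
top fraction `1/m`, for every profile and all small `γ`, BOTH `T3RegularMinimiser.MinimiserStabilityRegAt F γ b₀ p₀ m ε₀` (two-cut-off
consistency of the actions of Bałaban's REGULAR constrained minimisers, [Balaban1985Variational] Thm 1's background field of
[Balaban1985UV3] (41)) and `T3RegularMinimiser.FluctuationComparisonRegAt F γ b₀ p₀ m ε₀` (two-run comparison of (41)'s fluctuation
terms `Σ_j 𝒫_j + R`) hold, then `UnitTilt` — `T3RegularMinimiser.unitTilt_shape_of_reg` (common `ε₀ := min`, `m := max`, `γ₁ := min`;
`heightSandwichAt_of_bg`: the background | fluctuation split is functional-agnostic).  This is the glue a planner's re-split of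
`UnitTilt` over the regular-background twins would file; NOT a proof of K1.
-/

noncomputable section

open Literature.MathematicalPhysics.QuantumFieldTheory.Balaban1983to89
open Literature.MathematicalPhysics.QuantumFieldTheory.Balaban1983to89.T3ContinuumYM3Torus
open Literature.MathematicalPhysics.QuantumFieldTheory.Balaban1983to89.T3RegularMinimiser
open Summit.QuantumFields.YangMills.Theses.UnitScaleTilt

namespace Summit.QuantumFields.YangMills.Theorems

/-- **K1 ⇐ THE REGULAR-BACKGROUND TWINS** (each «for all sufficiently small `ε₀`», eventually in `m`, below a threshold `γ₁(ε₀, m, b₀, p₀)`):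
`MinimiserStabilityReg`-prefix → `FluctuationComparisonReg`-prefix → `UnitTilt`. -/
theorem unitScaleTilt_unitTilt_of_reg
    (h₁ : ∀ L : ℕ, ∃ ε₁ : ℝ, 0 < ε₁ ∧ ∀ ε₀ : ℝ, 0 < ε₀ → ε₀ ≤ ε₁ → ∃ m₀ : ℕ, ∀ m : ℕ, m₀ ≤ m → ∀ b₀ p₀ : ℝ, 0 < b₀ → 2 < p₀ →
      ∃ γ₁ : ℝ, 0 < γ₁ ∧ ∀ (F : T3Family) (γ : ℝ), F.L = L → 0 < γ → γ ≤ γ₁ → MinimiserStabilityRegAt F γ b₀ p₀ m ε₀)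
    (h₂ : ∀ L : ℕ, ∃ ε₁ : ℝ, 0 < ε₁ ∧ ∀ ε₀ : ℝ, 0 < ε₀ → ε₀ ≤ ε₁ → ∃ m₀ : ℕ, ∀ m : ℕ, m₀ ≤ m → ∀ b₀ p₀ : ℝ, 0 < b₀ → 2 < p₀ →
      ∃ γ₁ : ℝ, 0 < γ₁ ∧ ∀ (F : T3Family) (γ : ℝ), F.L = L → 0 < γ → γ ≤ γ₁ → FluctuationComparisonRegAt F γ b₀ p₀ m ε₀) :
    UnitTilt :=
  fun L => unitTilt_shape_of_reg L (h₁ L) (h₂ L)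

end Summit.QuantumFields.YangMills.Theorems

end
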